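import Summits.QuantumFields.YangMills.Theorems.BalabanUVNodesN22FadingLetterFirstEntryOnly
import Summits.QuantumFields.YangMills.Theorems.BalabanUVNodesN18RunningBetaLettersModelNodes

/-!
# BalabanUVNodes ∕ node N22 = NE9 — THE F-E SHADOW ON NODE N22's FADING LETTER, A6 RIDER: THE GEOMETRIC-FORGETTING FIRST-ENTRY-ONLY TOY — `…N22FadingLetterFirstEntryOnly`
# §1's whole antecedent {FE, NE9, fading memory} is JOINTLY INHABITED with NONZERO bare-coupling dependence, N22's letter HOLDS there, and the rigidity rate `ω^{k+1}` is SHARP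
# (MODEL LEVEL; contrast: CRIT-2's marginal-transport toy, where the letter fails)

Cell `pub-ymgap`, HUMAN RULING D-0062 (Track A), WIDTH SEAT `pub-ymgap-dag-n22-w2` (g5; A6-residue FLAG №3 lane of node N22).  THEOREMS ONLY (no `def`, no `sorry`,
standard axioms); `--kind proof --supports stmt-QuantumFields-27366 --as helper` (K3⁸ `SpineGivenEndpointR13SepCoPHV`, dag-lead KEY MAP v2), COUNT-NEUTRAL.  Imports this seat's
`…Theorems.BalabanUVNodesN22FadingLetterFirstEntryOnly` (rigidity from N22's letter under first-entry-only kernels; the marginal-transport failure) and dag-n18-w2's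
`…Theorems.BalabanUVNodesN18RunningBetaLettersModelNodes` (`ne9_EA_cross`: NE9 of the two-bond family from a history-Lipschitz amplitude law), BY NAME.  Nothing re-declared; the
amplitude law is DISPLAYED as a hypothesis `ha`, exactly as width seat dag-n18-w1 g6 displays its marginal-transport law.

WHY.  `…N22FadingLetterFirstEntryOnly` §1 proved: FE (kernels read the bare coupling only) ∧ N22's letter `NE9 … Λ` ∧ `FadingMemory C₉ ω Λ` ⟹ the kernels forget the bare coupling
at the geometric rate `C₉ω^{k+1}`; §3 showed the letter FAILS at CRIT-2's marginal-transport toy (polynomial forgetting).  A referee's A2∕A6 question on §1 is then: is the antecedent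
{FE, NE9, fading memory} inhabited AT ALL by kernels that genuinely read the bare coupling — or is the rigidity theorem about the empty set?  THIS FILE: the OTHER first-entry-only toy,
GEOMETRIC FORGETTING — dag-n18-w2's two-bond family with the amplitude law `a k v = β₀ + α·ω^{k+1}·(v 0)²∕2` (`0 ≤ ω < 1`).  Its kernels read `v 0` only (FE, `kernelA_firstEntryOnly_geomForget`),
the bare-pair difference of the mixed entry is EXACTLY `α·ω^{k+1}·(s² − t²)∕2` (`kernelA_zero_one_sub_geomForget`), so N22's letter HOLDS with the record's moduli SHAPE
`(wt κ e·|α|γ)·ω^{n−i}` (`ne9_EA_geomForget`, by `ne9_EA_cross`), the antecedent of §1 is JOINTLY inhabited (`firstEntryOnly_and_ne9_fading_geomForget`) with NONZERO bare-coupling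
dependence (`kernelA_zero_one_ne_geomForget`, `α ≠ 0`, `ω > 0`), §1's bound is met by the exact difference and NO FASTER RATE holds (`not_forget_faster_geomForget`: for `ω′ < ω` no
constant `C` gives `|ΔΠ_{k+1}| ≤ C·ω′^{k+1}` at the bare pair `γ, γ∕2`) — the rigidity rate `ω^{k+1}` is SHARP; and `N22At` HOLDS at node U3's objects of this family for every block
dominating `(wt·|α|γ, ω)` (`n22At_objects_geomForget`), an explicit such block existing for every `0 ≤ κ`, `0 ≤ ω < 1` (`n22At_objects_geomForget_block`).  With `…FirstEntryOnly` §3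
this makes the census line exact: UNDER FE, N22's conjunct `h9` holds iff the record's kernels forget the bare coupling at a geometric rate — marginal transport: NO; geometric
forgetting: YES (`n22At_geomForget_and_not_marginalTransport`).

HONEST FRAMING (binding).  MODEL LEVEL A6 rider (scalar two-bond test functionals at the identity chart); FE of the RECORD is never asserted; nothing of Bałaban's is proved or
asserted; NE5 ∕ NE9 NOT PRINTED for d = 4; no stub ∕ item refuted or discharged; N22 ∕ N18 NOT discharged (typed 28∕28 · discharged 5∕27 UNMOVED — the chair's single count line
is the only count); K3⁸ OPEN, not claimed; one finite 𝕋⁴ programme at fixed ε — R4 closes the CONDITIONAL rung `BalabanLadder.UV` only; NOTHING about the continuum limit, ℝ⁴,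
infinite volume, OS axioms, a mass gap or the Clay problem is proved or claimed.  References (TYPES only): [I] = Bałaban, CMP 109 (1987) Thm 1 p. 259, (1.18) p. 263, (1.20)–(1.22)
p. 264, §5 p. 298; [II] = CMP 116 (1988) (2.13)–(2.14) pp. 14–15.
-/

noncomputable section

open Filter Topology Set
open scoped BigOperators

namespace YMDAG.N22.FadingLetterFirstEntryOnly.RigidModel

open Literature.MathematicalPhysics.QuantumFieldTheory.Balaban1983to89
open Literature.MathematicalPhysics.QuantumFieldTheory.Balaban1983to89.T4Continuum (T4Family)
open Literature.MathematicalPhysics.QuantumFieldTheory.Balaban1983to89.T4OutputRate (Window NE9 FadingMemory)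
open Literature.MathematicalPhysics.QuantumFieldTheory.Balaban1983to89.FlowStep (HBeta)
open Literature.MathematicalPhysics.QuantumFieldTheory.Balaban1983to89.Node00 (Stage13Params U3Letters₁₁)
open Literature.MathematicalPhysics.QuantumFieldTheory.Balaban1983to89.Node00.U3OfKernels (histPrefix histPrefix_apply kernelA EA objects)
open YMDAG.UVSplit (N22At u3OfRecord₁₃)
open YMDAG.N22.AtKernels (n22At_u3OfRecord₁₃_objects_iff)
open YMDAG.N22.KernelFading (ne9_mono)
open YMDAG.N22.FadingLetterFirstEntryOnly (abs_kernelA_sub_le_of_ne9_fading_firstEntryOnly not_n22At_objects_marginalTransport)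
open YMDAG.N18.RunningBetaLettersModel (crossKernel_zero_one wt wt_nonneg crossTermFamily kernelA_crossTermFamily ne9_EA_cross)

variable (F : T4Family) {a : HBeta} {β₀ α ω : ℝ}

/-- **FE HOLDS**: the kernels of the geometric-forgetting two-bond family read the BARE coupling only. [folklore] -/
theorem kernelA_firstEntryOnly_geomForget (ha : ∀ (k : ℕ) (v : Fin (k + 1) → ℝ), a k v = β₀ + α * ω ^ (k + 1) * (v 0) ^ 2 / 2) (e : Fin 4 → ℤ) (γ : ℝ) :
    ∀ g ∈ Window γ, ∀ g' ∈ Window γ, g 0 = g' 0 → ∀ (k : ℕ) (μ ν : Fin 4) (z : Fin 4 → ℤ),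
      kernelA F (crossTermFamily F a e) (ContinuousLinearMap.id ℝ ℝ) (Module.Basis.singleton Unit ℝ) g k μ ν z =
        kernelA F (crossTermFamily F a e) (ContinuousLinearMap.id ℝ ℝ) (Module.Basis.singleton Unit ℝ) g' k μ ν z := by
  intro g _ g' _ h0 k μ ν z
  rw [kernelA_crossTermFamily, kernelA_crossTermFamily, ha, ha]
  simp only [histPrefix_apply, Fin.val_zero, h0]

/-- **THE BARE-PAIR DIFFERENCE OF THE MIXED ENTRY IS EXACTLY `α·ω^{k+1}·(g_0² − g_0′²)∕2`.** [folklore] -/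
theorem kernelA_zero_one_sub_geomForget (ha : ∀ (k : ℕ) (v : Fin (k + 1) → ℝ), a k v = β₀ + α * ω ^ (k + 1) * (v 0) ^ 2 / 2) (e : Fin 4 → ℤ) (g g' : ℕ → ℝ) (k : ℕ) :
    kernelA F (crossTermFamily F a e) (ContinuousLinearMap.id ℝ ℝ) (Module.Basis.singleton Unit ℝ) g k 0 1 e -
        kernelA F (crossTermFamily F a e) (ContinuousLinearMap.id ℝ ℝ) (Module.Basis.singleton Unit ℝ) g' k 0 1 e =
      α * ω ^ (k + 1) * ((g 0) ^ 2 - (g' 0) ^ 2) / 2 := by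
  rw [kernelA_crossTermFamily, kernelA_crossTermFamily, crossKernel_zero_one, crossKernel_zero_one, if_pos rfl, if_pos rfl, ha, ha]
  simp only [histPrefix_apply, Fin.val_zero]
  ring

/-- **NONZERO BARE-COUPLING DEPENDENCE** (`α ≠ 0`, `0 < ω`): two window histories with DIFFERENT bare couplings have different level-`(k+1)` mixed entries, for every `k`. [folklore] -/
theorem kernelA_zero_one_ne_geomForget (ha : ∀ (k : ℕ) (v : Fin (k + 1) → ℝ), a k v = β₀ + α * ω ^ (k + 1) * (v 0) ^ 2 / 2) (hα : α ≠ 0) (hω : 0 < ω)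
    (e : Fin 4 → ℤ) {γ : ℝ} {g g' : ℕ → ℝ} (hg : g ∈ Window γ) (hg' : g' ∈ Window γ) (hne : g 0 ≠ g' 0) (k : ℕ) :
    kernelA F (crossTermFamily F a e) (ContinuousLinearMap.id ℝ ℝ) (Module.Basis.singleton Unit ℝ) g k 0 1 e ≠
      kernelA F (crossTermFamily F a e) (ContinuousLinearMap.id ℝ ℝ) (Module.Basis.singleton Unit ℝ) g' k 0 1 e := by
  intro h
  have hsub := kernelA_zero_one_sub_geomForget F ha e g g' k
  rw [h, sub_self] at hsub
  have h2 : (g 0) ^ 2 - (g' 0) ^ 2 = 0 := by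
    have hω' : ω ^ (k + 1) ≠ 0 := pow_ne_zero _ hω.ne'
    have : α * ω ^ (k + 1) * ((g 0) ^ 2 - (g' 0) ^ 2) = 0 := by linarith
    rcases mul_eq_zero.1 this with h1 | h1
    · exact absurd (mul_eq_zero.1 h1) (not_or.2 ⟨hα, hω'⟩)
    · exact h1
  exact hne ((sq_eq_sq₀ (hg 0).1.le (hg' 0).1.le).1 (by linarith))

/-- **THE AMPLITUDE IS HISTORY-LIPSCHITZ WITH THE GEOMETRIC BARE-ENTRY MODULUS** (bounded by the record's moduli SHAPE `|α|γ·ω^{k+1−i}` — only `i = 0` is used; `0 ≤ ω`).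
[folklore] -/
theorem geomForget_lipschitz (ha : ∀ (k : ℕ) (v : Fin (k + 1) → ℝ), a k v = β₀ + α * ω ^ (k + 1) * (v 0) ^ 2 / 2) (hω : 0 ≤ ω) (γ : ℝ) :
    ∀ g ∈ Window γ, ∀ g' ∈ Window γ, ∀ k,
      |a k (histPrefix g k) - a k (histPrefix g' k)| ≤ ∑ i ∈ Finset.range (k + 1), |α| * γ * ω ^ (k + 1 - i) * |g i - g' i| := by
  intro g hg g' hg' k
  rw [ha, ha]
  simp only [histPrefix_apply, Fin.val_zero]
  have h1 := hg 0
  have h2 := hg' 0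
  have hq : |β₀ + α * ω ^ (k + 1) * g 0 ^ 2 / 2 - (β₀ + α * ω ^ (k + 1) * g' 0 ^ 2 / 2)| ≤ |α| * γ * ω ^ (k + 1 - 0) * |g 0 - g' 0| := by
    rw [show β₀ + α * ω ^ (k + 1) * g 0 ^ 2 / 2 - (β₀ + α * ω ^ (k + 1) * g' 0 ^ 2 / 2) = α * ω ^ (k + 1) * ((g 0 + g' 0) / 2) * (g 0 - g' 0) by ring,
      abs_mul, abs_mul, abs_mul, abs_of_nonneg (pow_nonneg hω _), abs_of_pos (by linarith [h1.1, h2.1] : (0 : ℝ) < (g 0 + g' 0) / 2), Nat.sub_zero]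
    have hmid : (g 0 + g' 0) / 2 ≤ γ := by linarith [h1.2, h2.2]
    have hA : 0 ≤ |α| * ω ^ (k + 1) := mul_nonneg (abs_nonneg α) (pow_nonneg hω _)
    calc |α| * ω ^ (k + 1) * ((g 0 + g' 0) / 2) * |g 0 - g' 0| ≤ |α| * ω ^ (k + 1) * γ * |g 0 - g' 0| :=
        mul_le_mul_of_nonneg_right (mul_le_mul_of_nonneg_left hmid hA) (abs_nonneg _)
      _ = |α| * γ * ω ^ (k + 1) * |g 0 - g' 0| := by ring
  refine hq.trans ?_
  have hnn : ∀ i ∈ Finset.range (k + 1), 0 ≤ |α| * γ * ω ^ (k + 1 - i) * |g i - g' i| := fun i _ => by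
    have hγ : 0 ≤ γ := h1.1.le.trans h1.2
    positivity
  exact Finset.single_le_sum hnn (Finset.mem_range.2 (Nat.succ_pos k))

/-- ★ **N22's LETTER HOLDS AT THE GEOMETRIC-FORGETTING TOY WITH THE RECORD's MODULI SHAPE**: `NE9 (EA …) (Window γ) κ (fun n i ↦ (wt κ e·|α|·γ)·ω^{n−i})` at every rate `κ`
(dag-n18-w2's `ne9_EA_cross` on the Lipschitz law, then `ne9_mono` to re-associate the constant).  MODEL LEVEL. [folklore] -/
theorem ne9_EA_geomForget (ha : ∀ (k : ℕ) (v : Fin (k + 1) → ℝ), a k v = β₀ + α * ω ^ (k + 1) * (v 0) ^ 2 / 2) (hω : 0 ≤ ω) (γ : ℝ) (e : Fin 4 → ℤ) (κ : ℝ) :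
    NE9 (EA F (crossTermFamily F a e) (ContinuousLinearMap.id ℝ ℝ) (Module.Basis.singleton Unit ℝ)) (Window γ) κ (fun n i => wt κ e * |α| * γ * ω ^ (n - i)) := by
  have h := ne9_EA_cross (Λ := fun n i => |α| * γ * ω ^ (n - i)) F (geomForget_lipschitz ha hω γ) e κ
  by_cases hγ : 0 ≤ γ
  · exact ne9_mono h le_rfl (fun n i => le_of_eq (by ring)) (fun n i => by have := wt_nonneg κ e; positivity)
  · -- an empty window: the letter holds vacuously
    intro g hg
    exact absurd ((hg 0).1.le.trans (hg 0).2) hγ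

/-- **THE MODULI FADE** (`0 ≤ ω`): `FadingMemory (wt κ e·|α|·γ) ω (fun n i ↦ (wt κ e·|α|·γ)·ω^{n−i})` for `0 ≤ γ`. [folklore] -/
theorem fadingMemory_geomForget (hω : 0 ≤ ω) {γ : ℝ} (hγ : 0 ≤ γ) (α : ℝ) (e : Fin 4 → ℤ) (κ : ℝ) :
    FadingMemory (wt κ e * |α| * γ) ω (fun n i => wt κ e * |α| * γ * ω ^ (n - i)) :=
  fun _ _ _ => ⟨by have := wt_nonneg κ e; positivity, le_rfl⟩

/-- ★★ **`…N22FadingLetterFirstEntryOnly` §1's WHOLE ANTECEDENT IS JOINTLY INHABITED, NON-DEGENERATELY**: at the geometric-forgetting toy (`α ≠ 0`, `0 < ω < 1`, `0 < γ`) the three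
displayed inputs of `abs_kernelA_sub_le_of_ne9_fading_firstEntryOnly` — FE, `NE9 … Λ`, `FadingMemory C₉ ω Λ` — hold TOGETHER, while the kernels DO read the bare coupling (two
histories with bare couplings `γ ≠ γ∕2` have different mixed entries at every level).  So the rigidity theorem is NOT about the empty set.  MODEL LEVEL. [folklore] -/
theorem firstEntryOnly_and_ne9_fading_geomForget (ha : ∀ (k : ℕ) (v : Fin (k + 1) → ℝ), a k v = β₀ + α * ω ^ (k + 1) * (v 0) ^ 2 / 2) (hα : α ≠ 0) (hω : 0 < ω)
    {γ : ℝ} (hγ : 0 < γ) (e : Fin 4 → ℤ) (κ : ℝ) :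
    (∀ g ∈ Window γ, ∀ g' ∈ Window γ, g 0 = g' 0 → ∀ (k : ℕ) (μ ν : Fin 4) (z : Fin 4 → ℤ),
      kernelA F (crossTermFamily F a e) (ContinuousLinearMap.id ℝ ℝ) (Module.Basis.singleton Unit ℝ) g k μ ν z =
        kernelA F (crossTermFamily F a e) (ContinuousLinearMap.id ℝ ℝ) (Module.Basis.singleton Unit ℝ) g' k μ ν z) ∧
    NE9 (EA F (crossTermFamily F a e) (ContinuousLinearMap.id ℝ ℝ) (Module.Basis.singleton Unit ℝ)) (Window γ) κ (fun n i => wt κ e * |α| * γ * ω ^ (n - i)) ∧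
    FadingMemory (wt κ e * |α| * γ) ω (fun n i => wt κ e * |α| * γ * ω ^ (n - i)) ∧
    (∀ k : ℕ, kernelA F (crossTermFamily F a e) (ContinuousLinearMap.id ℝ ℝ) (Module.Basis.singleton Unit ℝ) (fun _ => γ) k 0 1 e ≠
      kernelA F (crossTermFamily F a e) (ContinuousLinearMap.id ℝ ℝ) (Module.Basis.singleton Unit ℝ) (fun _ => γ / 2) k 0 1 e) :=
  ⟨kernelA_firstEntryOnly_geomForget F ha e γ, ne9_EA_geomForget F ha hω.le γ e κ, fadingMemory_geomForget hω.le hγ.le α e κ,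
    fun k => kernelA_zero_one_ne_geomForget F ha hα hω e (g := fun _ => γ) (g' := fun _ => γ / 2) (fun _ => ⟨hγ, le_rfl⟩)
      (fun _ => ⟨by linarith, by linarith⟩) (by simp only [ne_eq]; linarith) k⟩

/-- ★ **THE RIGIDITY RATE `ω^{k+1}` IS SHARP**: at the bare pair `γ, γ∕2` the mixed entries differ by EXACTLY `|α|·(3γ²∕8)·ω^{k+1}`, so for NO faster rate `ω′ < ω` and NO constant `C`
does `|ΔΠ_{k+1}| ≤ C·ω′^{k+1}` hold at every level (`α ≠ 0`, `0 < ω`, `0 ≤ ω′`, `0 < γ`) — `…FirstEntryOnly` §1's conclusion cannot be improved in the rate at this inhabitant.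
MODEL LEVEL. [folklore] -/
theorem not_forget_faster_geomForget (ha : ∀ (k : ℕ) (v : Fin (k + 1) → ℝ), a k v = β₀ + α * ω ^ (k + 1) * (v 0) ^ 2 / 2) (hα : α ≠ 0) (hω : 0 < ω)
    {ω' : ℝ} (hω'0 : 0 ≤ ω') (hω' : ω' < ω) {γ : ℝ} (hγ : 0 < γ) (e : Fin 4 → ℤ) (C : ℝ) :
    ¬ ∀ k : ℕ, |kernelA F (crossTermFamily F a e) (ContinuousLinearMap.id ℝ ℝ) (Module.Basis.singleton Unit ℝ) (fun _ => γ) k 0 1 e -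
        kernelA F (crossTermFamily F a e) (ContinuousLinearMap.id ℝ ℝ) (Module.Basis.singleton Unit ℝ) (fun _ => γ / 2) k 0 1 e| ≤ C * ω' ^ (k + 1) := by
  intro h
  have hA : 0 < |α| * (3 * γ ^ 2 / 8) := by positivity
  -- the exact difference and the ratio `r = ω′∕ω ∈ [0, 1[`
  have hr0 : 0 ≤ ω' / ω := div_nonneg hω'0 hω.le
  have hr1 : ω' / ω < 1 := (div_lt_one hω).2 hω'
  have hk : ∀ k : ℕ, |α| * (3 * γ ^ 2 / 8) ≤ C * (ω' / ω) ^ (k + 1) := by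
    intro k
    have hx := h k
    rw [kernelA_zero_one_sub_geomForget F ha e] at hx
    have hval : |α * ω ^ (k + 1) * (γ ^ 2 - (γ / 2) ^ 2) / 2| = |α| * (3 * γ ^ 2 / 8) * ω ^ (k + 1) := by
      rw [show α * ω ^ (k + 1) * (γ ^ 2 - (γ / 2) ^ 2) / 2 = α * (3 * γ ^ 2 / 8) * ω ^ (k + 1) by ring, abs_mul, abs_mul,
        abs_of_nonneg (by positivity : (0 : ℝ) ≤ 3 * γ ^ 2 / 8), abs_of_nonneg (pow_nonneg hω.le _)]
    rw [hval] at hx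
    have hωk : 0 < ω ^ (k + 1) := pow_pos hω _
    have hx' : |α| * (3 * γ ^ 2 / 8) ≤ C * ω' ^ (k + 1) / ω ^ (k + 1) := by rw [le_div_iff₀ hωk]; exact hx
    calc |α| * (3 * γ ^ 2 / 8) ≤ C * ω' ^ (k + 1) / ω ^ (k + 1) := hx'
      _ = C * (ω' / ω) ^ (k + 1) := by rw [div_pow]; ring
  have ht : Tendsto (fun k : ℕ => C * (ω' / ω) ^ (k + 1)) atTop (𝓝 (C * 0)) :=
    ((tendsto_pow_atTop_nhds_zero_of_lt_one hr0 hr1).comp (tendsto_add_atTop_nat 1)).const_mul C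
  rw [mul_zero] at ht
  obtain ⟨K, hK⟩ := (Metric.tendsto_atTop.1 ht) (|α| * (3 * γ ^ 2 / 8)) hA
  have hKK := hK K le_rfl
  rw [Real.dist_eq, sub_zero] at hKK
  linarith [hk K, le_abs_self (C * (ω' / ω) ^ (K + 1))]

variable {N : ℕ} [NeZero N]

/-- ★ **`N22At` HOLDS AT NODE U3's OBJECTS OF THE GEOMETRIC-FORGETTING FAMILY** for every Stage-13 tuple `θ`, every run length `k` and every letter block `ℓ` with `ℓ.Signs` whose
fading pair DOMINATES the toy's: `ω ≤ ℓ.ω`, `wt ℓ.κ e·|α|·θ.γ ≤ ℓ.C₉` (dag-n22-w3's `n22At_u3OfRecord₁₃_objects_iff`, `ne9_mono`).  CONTRAST: `…FirstEntryOnly.not_n22At_objects_marginalTransport`.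
MODEL LEVEL. [folklore] -/
theorem n22At_objects_geomForget (ha : ∀ (k : ℕ) (v : Fin (k + 1) → ℝ), a k v = β₀ + α * ω ^ (k + 1) * (v 0) ^ 2 / 2) (hω : 0 ≤ ω) (e : Fin 4 → ℤ)
    (θ : Stage13Params F N) (ℓ : U3Letters₁₁) (hs : ℓ.Signs) (hωℓ : ω ≤ ℓ.ω) (hC : wt ℓ.κ e * |α| * θ.γ ≤ ℓ.C₉) (k : ℕ) :
    N22At (u3OfRecord₁₃ θ (objects F (crossTermFamily F a e) (ContinuousLinearMap.id ℝ ℝ) (Module.Basis.singleton Unit ℝ) ℓ) k) := by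
  refine (n22At_u3OfRecord₁₃_objects_iff F (crossTermFamily F a e) (ContinuousLinearMap.id ℝ ℝ) (Module.Basis.singleton Unit ℝ) θ ℓ hs k).2 ?_
  refine ne9_mono (ne9_EA_geomForget F ha hω θ.γ e ℓ.κ) le_rfl (fun n i => ?_) hs.moduli_nonneg
  rw [U3Letters₁₁.moduli_apply]
  exact mul_le_mul hC (pow_le_pow_left₀ hω hωℓ _) (pow_nonneg hω _) hs.C₉_nonneg

/-- **AN EXPLICIT DOMINATING BLOCK WITH SIGNS** (`0 ≤ κ`, `0 ≤ ω < 1`, `0 ≤ θ.γ`): `⟨κ, (1+ω)∕2, 0, wt κ e·|α|·θ.γ, ω, 0, (1+ω)∕2⟩` — so `N22At` at the geometric-forgetting objects is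
inhabited OUTRIGHT, every `θ`, `k`.  MODEL LEVEL. [folklore] -/
theorem n22At_objects_geomForget_block (ha : ∀ (k : ℕ) (v : Fin (k + 1) → ℝ), a k v = β₀ + α * ω ^ (k + 1) * (v 0) ^ 2 / 2) {κ : ℝ} (hκ : 0 ≤ κ)
    (hω : 0 ≤ ω) (hω1 : ω < 1) (e : Fin 4 → ℤ) (θ : Stage13Params F N) (hγ : 0 ≤ θ.γ) (k : ℕ) :
    N22At (u3OfRecord₁₃ θ (objects F (crossTermFamily F a e) (ContinuousLinearMap.id ℝ ℝ) (Module.Basis.singleton Unit ℝ)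
      (⟨κ, (1 + ω) / 2, 0, wt κ e * |α| * θ.γ, ω, 0, (1 + ω) / 2⟩ : U3Letters₁₁)) k) := by
  have hw := wt_nonneg κ e
  have hsigns : U3Letters₁₁.Signs ⟨κ, (1 + ω) / 2, 0, wt κ e * |α| * θ.γ, ω, 0, (1 + ω) / 2⟩ :=
    ⟨hκ, by show (0 : ℝ) < (1 + ω) / 2; linarith, by show (1 + ω) / 2 < 1; linarith, le_rfl, by show 0 ≤ wt κ e * |α| * θ.γ; positivity, hω, hω1, le_rfl, le_rfl,
      by show ω ≤ (1 + ω) / 2; linarith, by show (1 + ω) / 2 < 1; linarith⟩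
  exact n22At_objects_geomForget F ha hω e θ _ hsigns le_rfl le_rfl k

/-- ★★ **THE CENSUS LINE, EXACT**: at ONE AND THE SAME letter block, Stage-13 tuple and run length, `N22At` HOLDS at node U3's objects of the GEOMETRIC-FORGETTING family and FAILS at
those of CRIT-2's MARGINAL-TRANSPORT family (`…FirstEntryOnly.not_n22At_objects_marginalTransport`) — both first-entry-only: under FE what decides N22's letter is whether the
bare-coupling memory decays at a geometric rate.  MODEL LEVEL; nothing of the record asserted. [folklore] -/
theorem n22At_geomForget_and_not_marginalTransport {a₁ a₂ : HBeta} {β₁ α₁ c : ℝ}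
    (ha₁ : ∀ (k : ℕ) (v : Fin (k + 1) → ℝ), a₁ k v = β₀ + α * ω ^ (k + 1) * (v 0) ^ 2 / 2)
    (ha₂ : ∀ (k : ℕ) (v : Fin (k + 1) → ℝ), a₂ k v = β₁ + α₁ * (v 0) ^ 2 / (1 + c * k * (v 0) ^ 2)) (hα₁ : α₁ ≠ 0) (hc : 0 ≤ c)
    {κ : ℝ} (hκ : 0 ≤ κ) (hω : 0 ≤ ω) (hω1 : ω < 1) (e : Fin 4 → ℤ) (θ : Stage13Params F N) (hγ : 0 < θ.γ) (k : ℕ) :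
    N22At (u3OfRecord₁₃ θ (objects F (crossTermFamily F a₁ e) (ContinuousLinearMap.id ℝ ℝ) (Module.Basis.singleton Unit ℝ)
        (⟨κ, (1 + ω) / 2, 0, wt κ e * |α| * θ.γ, ω, 0, (1 + ω) / 2⟩ : U3Letters₁₁)) k) ∧
      ¬ N22At (u3OfRecord₁₃ θ (objects F (crossTermFamily F a₂ e) (ContinuousLinearMap.id ℝ ℝ) (Module.Basis.singleton Unit ℝ)
        (⟨κ, (1 + ω) / 2, 0, wt κ e * |α| * θ.γ, ω, 0, (1 + ω) / 2⟩ : U3Letters₁₁)) k) := by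
  have hw := wt_nonneg κ e
  have hsigns : U3Letters₁₁.Signs ⟨κ, (1 + ω) / 2, 0, wt κ e * |α| * θ.γ, ω, 0, (1 + ω) / 2⟩ :=
    ⟨hκ, by show (0 : ℝ) < (1 + ω) / 2; linarith, by show (1 + ω) / 2 < 1; linarith, le_rfl, by show 0 ≤ wt κ e * |α| * θ.γ; positivity, hω, hω1, le_rfl, le_rfl,
      by show ω ≤ (1 + ω) / 2; linarith, by show (1 + ω) / 2 < 1; linarith⟩
  exact ⟨n22At_objects_geomForget_block F ha₁ hκ hω hω1 e θ hγ.le k, not_n22At_objects_marginalTransport F ha₂ hα₁ hc e θ hγ _ hsigns k⟩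

end YMDAG.N22.FadingLetterFirstEntryOnly.RigidModel

end
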